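import Summits.NavierStokesRegularity.FluidComputer.LevelReynoldsFloor
import Summits.NavierStokesRegularity.FluidComputer.LevelRatioFloor
import Literature.Analysis.FluidPDE.NSCriticalClosureBesovProofs
import Literature.Analysis.FluidPDE.MollifiedSliceTools
import Literature.Analysis.FluidPDE.LittlewoodPaleyBlockFn
import Literature.Analysis.FunctionSpaces.LittlewoodPaleyBernsteinProofs

/-!
# Fluid computer — the level-ENERGY floor (rung R1's `μ = λ η ≥ 1` as a tail theorem; idea-1 gen 6 sketch, pub-fluidc)

HONEST FRAMING (cell `pub-fluidc`, verbatim): *low prior, high value-of-information experiment on Tao's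
machine paradigm; NOT a claim that NS blows up.* Theorem side of the cell; nothing here is evidence of blow-up.

Provenance: written by the cell's ideation seat idea-1 (planner-pub-fluidc-idea-1, gen 6; staged as
`HOME/pub-fluidc-idea-1/lean/LevelEnergyFloor.lean`, sha16 `36df062c45567e9d`) and filed through the gate verbatim
(up to this sentence) by the literature seat pub-fluidc-lit gen 35 on idea-1's STATUS ASK of 2026-08-23T02:26Z.

The cell's retired rung R1 read a per-step ENERGY-transfer efficiency `η = E_out / E_in` against the floor
`μ := λ η ≥ 1`, derived (HOME/PLAN.md §0) for a *blob-like self-similar* cascade.  This file shows that the floor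
needs neither assumption, in the tail form the tree's level-Reynolds floor already has:

* `level_energy_frequently_gt` — there are absolute `c > 0`, `C` with: for every maximal smooth solution `(u, p)` of
  the unforced system with finite lifespan `T`, Leray–Hopf from `u 0`, slice distributions `U t`, at INFINITELY MANY
  dyadic levels `j` there is a time `t ∈ (0,T)` with `c ν < C · 2^{j/2} · ‖Δ̇_j U(t)‖_{L²}` — the level carries energy
  `‖Δ̇_j u(t)‖₂² > (c ν / C)² 2^{-j}`, the energy of ONE eddy of width `2^{-j}` at the floor velocity `c ν 2^j`
  (floor L2 of `LevelReynoldsFloor` at `(j,t)` × Bernstein `‖Δ̇_j v‖_∞ ≤ C₁ 2^{3j/2} ‖Δ̇_j v‖₂`).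
* `sup_weight_le_rms_weight` — the INSTRUMENT ORDERING behind it, solution-free: the amplitude rung's level weight
  `S j = sup_t 2^{-j} ‖Δ̇_j U(t)‖_∞` is at most `C₁` times the energy rung's level weight
  `Q j := 2^{j/2} sup_t ‖Δ̇_j U(t)‖₂` (Bernstein).  An R2 floor event forces an R1 floor event at the same level; there
  is no inequality the other way (a thin sheet has large `Q j`, small `S j`), so R2 strictly dominates R1 as a rung.
* `rms_weight_le_energy` / `rms_weight_ne_top` — the matching a-priori CEILING `Q j ≤ C₂ 2^{j/2} ‖u 0‖₂` (uniform
  `L²`-boundedness of the blocks and the energy inequality), whence finiteness of every `Q j`.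
* `level_energy_ratio_frequently_gt` — **R1's floor, constant-free and hypothesis-free**: for every `a < 1`, at
  infinitely many levels `a · Q j < Q (j+1)`, i.e. the successive level-energy ratio
  `η_j := (sup_t ‖Δ̇_{j+1} u‖₂ / sup_t ‖Δ̇_j u‖₂)²` exceeds `a²/2` — in the rung's units (`λ = 2`) `μ_j = λ η_j > a²`
  — infinitely often: `limsup_j μ_j ≥ 1` for EVERY blow-up, blob or not, self-similar or not
  (`not_eventually_level_energy_contraction` is the contrapositive wording).
* `joint_level_floor_frequently` — at infinitely many levels ONE time carries both floors (sup and energy).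

Reading for the atlas (HOME/atlas/IDEA-1.md §10): the measured `η̂ ≈ 0.08–0.30` per octave of the retired R1 rows
(`μ̂ ≈ 0.16–0.6`) are sub-floor under a THEOREM about the tail, exactly like the R2 rows (`r ≤ 0.482 < 1`); and, as for
R2, nothing is asserted at any fixed finite set of levels.  K41 (`η = 2^{-2/3} ≈ 0.63`, `μ = 2^{1/3}`) passes this
floor — R1 cannot separate a developed cascade from a machine, R2 (`r_K41 = λ^{-4/3} < 1 ≤ r_floor`) can: the second
reason R2 dominates.
-/

noncomputable section

open MeasureTheory Set Function Filter Topology TemperedDistribution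
open scoped ENNReal NNReal SchwartzMap
open Literature.Analysis.FluidPDE Literature.Analysis.FunctionSpaces

namespace Summit.NavierStokesRegularity.FluidComputer.LevelEnergyFloor

-- The two helper lemmas `frequently_ratio_gt_of_frequently_ge` and `ennreal_frequently_ratio_gt` of the gen-5
-- file now live in the tree (`LevelRatioFloor`, p349586) and are reused from there (gate dedup rule).
open Summit.NavierStokesRegularity.FluidComputer.LevelRatioFloor
  (frequently_ratio_gt_of_frequently_ge ennreal_frequently_ratio_gt)

/-- Cancelling a constant: if `ofReal c < C * Q j` frequently (`c > 0`, `C : ℝ≥0`) and every `Q j` is finite, then for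
every `a < 1`, `a * Q j < Q (j+1)` frequently. -/
theorem ennreal_frequently_ratio_gt_of_const_mul {Q : ℕ → ℝ≥0∞} {C : ℝ≥0} {c : ℝ} (hc : 0 < c)
    (hfreq : ∃ᶠ j in atTop, ENNReal.ofReal c < (C : ℝ≥0∞) * Q j) (hfin : ∀ j, Q j ≠ ∞)
    {a : ℝ≥0∞} (ha1 : a < 1) :
    ∃ᶠ j in atTop, a * Q j < Q (j + 1) := by
  have hfinS : ∀ j, (C : ℝ≥0∞) * Q j ≠ ∞ := fun j => ENNReal.mul_ne_top ENNReal.coe_ne_top (hfin j)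
  have h := ennreal_frequently_ratio_gt (S := fun j => (C : ℝ≥0∞) * Q j) hc hfreq hfinS ha1
  refine h.mono fun j hj => ?_
  by_contra hge
  rw [not_lt] at hge
  have : (C : ℝ≥0∞) * Q (j + 1) ≤ a * ((C : ℝ≥0∞) * Q j) :=
    calc (C : ℝ≥0∞) * Q (j + 1) ≤ (C : ℝ≥0∞) * (a * Q j) := mul_le_mul' le_rfl hge
      _ = a * ((C : ℝ≥0∞) * Q j) := by ring
  exact absurd hj (not_lt.mpr this)

/-- **Instrument ordering (Bernstein), solution-free.** There is an absolute constant `C` such that for every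
family of tempered distributions `U t` on `ℝ³`, every `T` and every level `j`: the amplitude rung's level weight is
dominated by the energy rung's, `sup_{t ∈ (0,T)} 2^{-j} ‖Δ̇_j U(t)‖_∞ ≤ C · 2^{j/2} · sup_{t ∈ (0,T)} ‖Δ̇_j U(t)‖₂`
(`‖Δ̇_j v‖_∞ ≤ C₁ 2^{3j/2} ‖Δ̇_j v‖₂`, `exists_eLpNormDistrib_lpBlock_le 2 ∞`).  So a floor event of R2 at level `j`
forces one of R1 at the same level; a thin vortex SHEET shows the converse fails. [folklore] -/
theorem sup_weight_le_rms_weight : ∃ C : ℝ≥0, ∀ (U : ℝ → 𝓢'(EuclideanSpace ℝ (Fin 3), EuclideanSpace ℂ (Fin 3)))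
    (T : ℝ) (j : ℕ),
      (⨆ t ∈ Ioo 0 T, lpBlockWeight (-1) ∞ (U t) (j : ℤ)) ≤
        C * ((2 : ℝ≥0∞) ^ ((j : ℝ) / 2) * ⨆ t ∈ Ioo 0 T, eLpNormDistrib 2 (lpBlock (j : ℤ) (U t))) := by
  obtain ⟨C₁, -, hB⟩ := exists_eLpNormDistrib_lpBlock_le
    (E := EuclideanSpace ℝ (Fin 3)) (F := EuclideanSpace ℂ (Fin 3)) 2 ∞ le_top
  refine ⟨C₁, fun U T j => ?_⟩
  have hexp : ((j : ℤ) : ℝ) * Module.finrank ℝ (EuclideanSpace ℝ (Fin 3)) *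
      ((2 : ℝ≥0∞).toReal⁻¹ - (∞ : ℝ≥0∞).toReal⁻¹) = 3 * (j : ℝ) / 2 := by
    simp; ring
  have hpow : (2 : ℝ≥0∞) ^ (((j : ℤ) : ℝ) * (-1 : ℝ)) * (2 : ℝ≥0∞) ^ (3 * (j : ℝ) / 2) =
      (2 : ℝ≥0∞) ^ ((j : ℝ) / 2) := by
    rw [← ENNReal.rpow_add _ _ (by norm_num) (by norm_num)]
    congr 1; push_cast; ring
  refine iSup₂_le fun t ht => ?_
  have hb := hB (j : ℤ) (U t)
  rw [hexp] at hb
  have hsup : eLpNormDistrib 2 (lpBlock (j : ℤ) (U t)) ≤ ⨆ t ∈ Ioo 0 T, eLpNormDistrib 2 (lpBlock (j : ℤ) (U t)) :=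
    le_iSup₂ (f := fun t (_ : t ∈ Ioo 0 T) => eLpNormDistrib 2 (lpBlock (j : ℤ) (U t))) t ht
  simp only [lpBlockWeight]
  calc (2 : ℝ≥0∞) ^ (((j : ℤ) : ℝ) * (-1 : ℝ)) * eLpNormDistrib ∞ (lpBlock (j : ℤ) (U t))
      ≤ (2 : ℝ≥0∞) ^ (((j : ℤ) : ℝ) * (-1 : ℝ)) *
          (C₁ * (2 : ℝ≥0∞) ^ (3 * (j : ℝ) / 2) * eLpNormDistrib 2 (lpBlock (j : ℤ) (U t))) :=
        mul_le_mul' le_rfl hb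
    _ = C₁ * ((2 : ℝ≥0∞) ^ ((j : ℝ) / 2) * eLpNormDistrib 2 (lpBlock (j : ℤ) (U t))) := by
        rw [← hpow]; ring
    _ ≤ C₁ * ((2 : ℝ≥0∞) ^ ((j : ℝ) / 2) * ⨆ t ∈ Ioo 0 T, eLpNormDistrib 2 (lpBlock (j : ℤ) (U t))) :=
        mul_le_mul' le_rfl (mul_le_mul' le_rfl hsup)

/-- **The level-energy floor at a floor event.** There are absolute constants `c > 0` and `C` such that for every
maximal smooth solution `(u, p)` of the unforced Navier–Stokes system with finite lifespan `T`, Leray–Hopf from `u 0`,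
with slice distributions `U t`: at INFINITELY MANY dyadic levels `j` there is a time `t ∈ (0,T)` at which
`c ν < C · 2^{j/2} · ‖Δ̇_j U(t)‖_{L²}` — i.e. the level energy `‖Δ̇_j u(t)‖₂²` exceeds `(c ν / C)² 2^{-j}`, the kinetic
energy of a single eddy of width `2^{-j}` moving at the floor velocity `c ν 2^j`.  From the level-Reynolds floor
`LevelReynoldsFloor.level_amplitude_frequently_gt` (Cheskidov–Shvydkoy) at `(j,t)` and Bernstein's inequality on the
block.  This is rung R1's energy floor with NO blob / self-similarity assumption, as a statement about the tail of the
level sequence. [cite: CheskidovShvydkoy2010, Lemma 3.2] -/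
theorem level_energy_frequently_gt : ∃ (c : ℝ) (C : ℝ≥0), 0 < c ∧
    ∀ (ν T : ℝ), 0 < ν → 0 < T → ∀ (u : ℝ → EuclideanSpace ℝ (Fin 3) → EuclideanSpace ℝ (Fin 3))
      (p : ℝ → EuclideanSpace ℝ (Fin 3) → ℝ)
      (U : ℝ → 𝓢'(EuclideanSpace ℝ (Fin 3), EuclideanSpace ℂ (Fin 3))),
      IsMaximalSmoothSolution ν 0 u p T → IsLerayHopfOn T ν 0 (u 0) u →
      (∀ t ∈ Icc 0 T, IsDistributionOf (u t) (U t)) →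
        ∃ᶠ j : ℕ in atTop, ∃ t ∈ Ioo 0 T,
          ENNReal.ofReal (c * ν) < C * (2 : ℝ≥0∞) ^ ((j : ℝ) / 2) * eLpNormDistrib 2 (lpBlock (j : ℤ) (U t)) := by
  obtain ⟨c, hc, H⟩ := LevelReynoldsFloor.level_amplitude_frequently_gt
  obtain ⟨C₁, -, hB⟩ := exists_eLpNormDistrib_lpBlock_le
    (E := EuclideanSpace ℝ (Fin 3)) (F := EuclideanSpace ℂ (Fin 3)) 2 ∞ le_top
  refine ⟨c / 2, C₁, by linarith, fun ν T hν hT u p U hmax hLH hU => ?_⟩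
  have hb : c / 2 < c := by linarith
  have hfreq := H ν T hν hT u p U hmax hLH hU (c / 2) hb
  refine hfreq.mono fun j hj => ?_
  rw [lt_iSup_iff] at hj
  obtain ⟨t, hjt⟩ := hj
  rw [lt_iSup_iff] at hjt
  obtain ⟨ht, hlt⟩ := hjt
  refine ⟨t, ht, ?_⟩
  simp only [lpBlockWeight] at hlt
  have hexp : ((j : ℤ) : ℝ) * Module.finrank ℝ (EuclideanSpace ℝ (Fin 3)) *
      ((2 : ℝ≥0∞).toReal⁻¹ - (∞ : ℝ≥0∞).toReal⁻¹) = 3 * (j : ℝ) / 2 := by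
    simp; ring
  have hpow : (2 : ℝ≥0∞) ^ (((j : ℤ) : ℝ) * (-1 : ℝ)) * (2 : ℝ≥0∞) ^ (3 * (j : ℝ) / 2) =
      (2 : ℝ≥0∞) ^ ((j : ℝ) / 2) := by
    rw [← ENNReal.rpow_add _ _ (by norm_num) (by norm_num)]
    congr 1; push_cast; ring
  have hb' := hB (j : ℤ) (U t)
  rw [hexp] at hb'
  calc ENNReal.ofReal (c / 2 * ν)
      < (2 : ℝ≥0∞) ^ (((j : ℤ) : ℝ) * (-1 : ℝ)) * eLpNormDistrib ∞ (lpBlock (j : ℤ) (U t)) := hlt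
    _ ≤ (2 : ℝ≥0∞) ^ (((j : ℤ) : ℝ) * (-1 : ℝ)) *
          (C₁ * (2 : ℝ≥0∞) ^ (3 * (j : ℝ) / 2) * eLpNormDistrib 2 (lpBlock (j : ℤ) (U t))) :=
        mul_le_mul' le_rfl hb'
    _ = C₁ * (2 : ℝ≥0∞) ^ ((j : ℝ) / 2) * eLpNormDistrib 2 (lpBlock (j : ℤ) (U t)) := by
        rw [← hpow]; ring

/-- **Joint floor event.** Same constants: at infinitely many levels `j` ONE time `t ∈ (0,T)` carries both the
level-Reynolds floor `c ν < 2^{-j} ‖Δ̇_j U(t)‖_∞` (weight form) and the level-energy floor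
`c ν < C 2^{j/2} ‖Δ̇_j U(t)‖₂` — the schema's sup-twin and rms-twin floors are simultaneous, level by level.
[cite: CheskidovShvydkoy2010, Lemma 3.2] -/
theorem joint_level_floor_frequently : ∃ (c : ℝ) (C : ℝ≥0), 0 < c ∧
    ∀ (ν T : ℝ), 0 < ν → 0 < T → ∀ (u : ℝ → EuclideanSpace ℝ (Fin 3) → EuclideanSpace ℝ (Fin 3))
      (p : ℝ → EuclideanSpace ℝ (Fin 3) → ℝ)
      (U : ℝ → 𝓢'(EuclideanSpace ℝ (Fin 3), EuclideanSpace ℂ (Fin 3))),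
      IsMaximalSmoothSolution ν 0 u p T → IsLerayHopfOn T ν 0 (u 0) u →
      (∀ t ∈ Icc 0 T, IsDistributionOf (u t) (U t)) →
        ∃ᶠ j : ℕ in atTop, ∃ t ∈ Ioo 0 T,
          ENNReal.ofReal (c * ν) < lpBlockWeight (-1) ∞ (U t) (j : ℤ) ∧
          ENNReal.ofReal (c * ν) < C * (2 : ℝ≥0∞) ^ ((j : ℝ) / 2) * eLpNormDistrib 2 (lpBlock (j : ℤ) (U t)) := by
  obtain ⟨c, hc, H⟩ := LevelReynoldsFloor.level_amplitude_frequently_gt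
  obtain ⟨C₁, -, hB⟩ := exists_eLpNormDistrib_lpBlock_le
    (E := EuclideanSpace ℝ (Fin 3)) (F := EuclideanSpace ℂ (Fin 3)) 2 ∞ le_top
  refine ⟨c / 2, C₁, by linarith, fun ν T hν hT u p U hmax hLH hU => ?_⟩
  have hb : c / 2 < c := by linarith
  have hfreq := H ν T hν hT u p U hmax hLH hU (c / 2) hb
  refine hfreq.mono fun j hj => ?_
  rw [lt_iSup_iff] at hj
  obtain ⟨t, hjt⟩ := hj
  rw [lt_iSup_iff] at hjt
  obtain ⟨ht, hlt⟩ := hjt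
  refine ⟨t, ht, hlt, ?_⟩
  have hlt' := hlt
  simp only [lpBlockWeight] at hlt'
  have hexp : ((j : ℤ) : ℝ) * Module.finrank ℝ (EuclideanSpace ℝ (Fin 3)) *
      ((2 : ℝ≥0∞).toReal⁻¹ - (∞ : ℝ≥0∞).toReal⁻¹) = 3 * (j : ℝ) / 2 := by
    simp; ring
  have hpow : (2 : ℝ≥0∞) ^ (((j : ℤ) : ℝ) * (-1 : ℝ)) * (2 : ℝ≥0∞) ^ (3 * (j : ℝ) / 2) =
      (2 : ℝ≥0∞) ^ ((j : ℝ) / 2) := by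
    rw [← ENNReal.rpow_add _ _ (by norm_num) (by norm_num)]
    congr 1; push_cast; ring
  have hb' := hB (j : ℤ) (U t)
  rw [hexp] at hb'
  calc ENNReal.ofReal (c / 2 * ν)
      < (2 : ℝ≥0∞) ^ (((j : ℤ) : ℝ) * (-1 : ℝ)) * eLpNormDistrib ∞ (lpBlock (j : ℤ) (U t)) := hlt'
    _ ≤ (2 : ℝ≥0∞) ^ (((j : ℤ) : ℝ) * (-1 : ℝ)) *
          (C₁ * (2 : ℝ≥0∞) ^ (3 * (j : ℝ) / 2) * eLpNormDistrib 2 (lpBlock (j : ℤ) (U t))) :=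
        mul_le_mul' le_rfl hb'
    _ = C₁ * (2 : ℝ≥0∞) ^ ((j : ℝ) / 2) * eLpNormDistrib 2 (lpBlock (j : ℤ) (U t)) := by
        rw [← hpow]; ring

/-- **Energy ceiling of the rms level weights.** There is an absolute `C` such that for every unforced Leray–Hopf
solution on `[0,T]` from `u 0` with slice distributions `U t` and every level `j`:
`Q j = 2^{j/2} sup_{t ∈ (0,T)} ‖Δ̇_j U(t)‖₂ ≤ C · 2^{j/2} · ‖u 0‖_{L²}` (uniform `L²`-boundedness of the blocks,
`exists_eLpNormDistrib_lpBlock_le_eLpNormDistrib 2`; `‖U(t)‖₂ = ‖u(t)‖₂`, `IsDistributionOf.eLpNormDistrib_eq`; the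
energy inequality `IsLerayHopfOn.eLpNorm_le_eLpNorm_datum`).  With `level_energy_frequently_gt` this BRACKETS the level
energies of a blow-up: `(c ν / C)² 2^{-j} < sup_t ‖Δ̇_j u(t)‖₂² ≤ C² ‖u 0‖₂²` at infinitely many `j`. [folklore] -/
theorem rms_weight_le_energy : ∃ C : ℝ≥0, ∀ (ν T : ℝ), 0 < ν → 0 < T →
    ∀ (u : ℝ → EuclideanSpace ℝ (Fin 3) → EuclideanSpace ℝ (Fin 3))
      (U : ℝ → 𝓢'(EuclideanSpace ℝ (Fin 3), EuclideanSpace ℂ (Fin 3))),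
      IsLerayHopfOn T ν 0 (u 0) u → (∀ t ∈ Icc 0 T, IsDistributionOf (u t) (U t)) →
      ∀ j : ℕ, (2 : ℝ≥0∞) ^ ((j : ℝ) / 2) * (⨆ t ∈ Ioo 0 T, eLpNormDistrib 2 (lpBlock (j : ℤ) (U t))) ≤
        C * (2 : ℝ≥0∞) ^ ((j : ℝ) / 2) * eLpNorm (u 0) 2 volume := by
  obtain ⟨C₂, hC₂⟩ := exists_eLpNormDistrib_lpBlock_le_eLpNormDistrib
    (E := EuclideanSpace ℝ (Fin 3)) (F := EuclideanSpace ℂ (Fin 3)) 2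
  refine ⟨C₂, fun ν T hν hT u U hLH hU j => ?_⟩
  have h0 : MemLp (u 0) 2 volume := hLH.memLp 0 ⟨le_rfl, hT.le⟩
  have hE : ∀ t ∈ Ioo 0 T, eLpNormDistrib 2 (U t) ≤ eLpNorm (u 0) 2 volume := fun t ht => by
    have ht' : t ∈ Icc 0 T := Ioo_subset_Icc_self ht
    rw [(hU t ht').eLpNormDistrib_eq (hLH.memLp t ht')]
    exact hLH.eLpNorm_le_eLpNorm_datum hν.le h0 ht'
  have hsup : (⨆ t ∈ Ioo 0 T, eLpNormDistrib 2 (lpBlock (j : ℤ) (U t))) ≤ C₂ * eLpNorm (u 0) 2 volume :=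
    iSup₂_le fun t ht => (hC₂ (j : ℤ) (U t)).trans (mul_le_mul' le_rfl (hE t ht))
  calc (2 : ℝ≥0∞) ^ ((j : ℝ) / 2) * (⨆ t ∈ Ioo 0 T, eLpNormDistrib 2 (lpBlock (j : ℤ) (U t)))
      ≤ (2 : ℝ≥0∞) ^ ((j : ℝ) / 2) * (C₂ * eLpNorm (u 0) 2 volume) := mul_le_mul' le_rfl hsup
    _ = C₂ * (2 : ℝ≥0∞) ^ ((j : ℝ) / 2) * eLpNorm (u 0) 2 volume := by ring

/-- Finiteness of the rms level weights `Q j = 2^{j/2} sup_{t ∈ (0,T)} ‖Δ̇_j U(t)‖₂` of an unforced Leray–Hopf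
solution (from `rms_weight_le_energy`). [folklore] -/
theorem rms_weight_ne_top {ν T : ℝ} (hν : 0 < ν) (hT : 0 < T)
    {u : ℝ → EuclideanSpace ℝ (Fin 3) → EuclideanSpace ℝ (Fin 3)}
    {U : ℝ → 𝓢'(EuclideanSpace ℝ (Fin 3), EuclideanSpace ℂ (Fin 3))}
    (hLH : IsLerayHopfOn T ν 0 (u 0) u) (hU : ∀ t ∈ Icc 0 T, IsDistributionOf (u t) (U t)) (j : ℕ) :
    (2 : ℝ≥0∞) ^ ((j : ℝ) / 2) * (⨆ t ∈ Ioo 0 T, eLpNormDistrib 2 (lpBlock (j : ℤ) (U t))) ≠ ∞ := by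
  obtain ⟨C, hC⟩ := rms_weight_le_energy
  have h0 : MemLp (u 0) 2 volume := hLH.memLp 0 ⟨le_rfl, hT.le⟩
  have h2 : ∀ y : ℝ, (2 : ℝ≥0∞) ^ y ≠ ∞ := fun y => by
    rw [Ne, ENNReal.rpow_eq_top_iff]; norm_num
  refine ne_top_of_le_ne_top ?_ (hC ν T hν hT u U hLH hU j)
  exact ENNReal.mul_ne_top (ENNReal.mul_ne_top ENNReal.coe_ne_top (h2 _)) h0.eLpNorm_ne_top

/-- **R1's floor `μ = λ η ≥ 1`, constant-free and hypothesis-free (tail form).** For every maximal smooth solution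
`(u, p)` of the unforced Navier–Stokes system with finite lifespan `T`, Leray–Hopf from `u 0`, with slice
distributions `U t`, and every `a < 1`: at INFINITELY MANY dyadic levels `j`, `a · Q j < Q (j+1)` where
`Q j := 2^{j/2} · sup_{t ∈ (0,T)} ‖Δ̇_j U(t)‖_{L²}`.  Unfolded: the successive level-energy ratio
`η_j = (sup_t ‖Δ̇_{j+1} u‖₂ / sup_t ‖Δ̇_j u‖₂)²` exceeds `a²/2` infinitely often, i.e. `μ_j = 2 η_j > a²` for every
`a < 1` — `limsup_j μ_j ≥ 1`, the floor HOME/PLAN.md §0 attributed to a blob-like self-similar cascade, now for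
EVERY blow-up (floor `level_energy_frequently_gt`, ceiling `rms_weight_ne_top`, and the ratio lemma).  As for the
amplitude rung, nothing is asserted about any fixed finite set of levels. [cite: CheskidovShvydkoy2010, Lemma 3.2] -/
theorem level_energy_ratio_frequently_gt :
    ∀ (ν T : ℝ), 0 < ν → 0 < T → ∀ (u : ℝ → EuclideanSpace ℝ (Fin 3) → EuclideanSpace ℝ (Fin 3))
      (p : ℝ → EuclideanSpace ℝ (Fin 3) → ℝ)
      (U : ℝ → 𝓢'(EuclideanSpace ℝ (Fin 3), EuclideanSpace ℂ (Fin 3))),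
      IsMaximalSmoothSolution ν 0 u p T → IsLerayHopfOn T ν 0 (u 0) u →
      (∀ t ∈ Icc 0 T, IsDistributionOf (u t) (U t)) →
      ∀ a : ℝ≥0∞, a < 1 →
        ∃ᶠ j : ℕ in atTop,
          a * ((2 : ℝ≥0∞) ^ ((j : ℝ) / 2) * ⨆ t ∈ Ioo 0 T, eLpNormDistrib 2 (lpBlock (j : ℤ) (U t))) <
            (2 : ℝ≥0∞) ^ (((j + 1 : ℕ) : ℝ) / 2) *
              ⨆ t ∈ Ioo 0 T, eLpNormDistrib 2 (lpBlock ((j + 1 : ℕ) : ℤ) (U t)) := by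
  intro ν T hν hT u p U hmax hLH hU a ha
  obtain ⟨c, C, hc, H⟩ := level_energy_frequently_gt
  have hfreq := H ν T hν hT u p U hmax hLH hU
  have hfreq' : ∃ᶠ j : ℕ in atTop, ENNReal.ofReal (c * ν) <
      (C : ℝ≥0∞) * ((2 : ℝ≥0∞) ^ ((j : ℝ) / 2) * ⨆ t ∈ Ioo 0 T, eLpNormDistrib 2 (lpBlock (j : ℤ) (U t))) := by
    refine hfreq.mono fun j hj => ?_
    obtain ⟨t, ht, hlt⟩ := hj
    have hsup : eLpNormDistrib 2 (lpBlock (j : ℤ) (U t)) ≤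
        ⨆ t ∈ Ioo 0 T, eLpNormDistrib 2 (lpBlock (j : ℤ) (U t)) :=
      le_iSup₂ (f := fun t (_ : t ∈ Ioo 0 T) => eLpNormDistrib 2 (lpBlock (j : ℤ) (U t))) t ht
    refine hlt.trans_le ?_
    rw [mul_assoc]
    exact mul_le_mul' le_rfl (mul_le_mul' le_rfl hsup)
  exact ennreal_frequently_ratio_gt_of_const_mul
    (Q := fun j : ℕ => (2 : ℝ≥0∞) ^ ((j : ℝ) / 2) * ⨆ t ∈ Ioo 0 T, eLpNormDistrib 2 (lpBlock (j : ℤ) (U t)))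
    (mul_pos hc hν) hfreq' (rms_weight_ne_top hν hT hLH hU) ha

/-- **Corollary — no eventual level-energy contraction below `1/λ`.** Under the hypotheses of
`level_energy_ratio_frequently_gt` there is no `a < 1` with `Q (j+1) ≤ a · Q j` for all large `j`: the level
energies of a blow-up cannot decay like `(a²/2)^j`, `a < 1`, from some level on — R1's `μ < 1 eventually` is
impossible, whatever the geometry of the carrier. [cite: CheskidovShvydkoy2010, Lemma 3.2] -/
theorem not_eventually_level_energy_contraction :
    ∀ (ν T : ℝ), 0 < ν → 0 < T → ∀ (u : ℝ → EuclideanSpace ℝ (Fin 3) → EuclideanSpace ℝ (Fin 3))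
      (p : ℝ → EuclideanSpace ℝ (Fin 3) → ℝ)
      (U : ℝ → 𝓢'(EuclideanSpace ℝ (Fin 3), EuclideanSpace ℂ (Fin 3))),
      IsMaximalSmoothSolution ν 0 u p T → IsLerayHopfOn T ν 0 (u 0) u →
      (∀ t ∈ Icc 0 T, IsDistributionOf (u t) (U t)) →
      ∀ a : ℝ≥0∞, a < 1 →
        ¬ ∀ᶠ j : ℕ in atTop,
          (2 : ℝ≥0∞) ^ (((j + 1 : ℕ) : ℝ) / 2) *
              (⨆ t ∈ Ioo 0 T, eLpNormDistrib 2 (lpBlock ((j + 1 : ℕ) : ℤ) (U t))) ≤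
            a * ((2 : ℝ≥0∞) ^ ((j : ℝ) / 2) * ⨆ t ∈ Ioo 0 T, eLpNormDistrib 2 (lpBlock (j : ℤ) (U t))) := by
  intro ν T hν hT u p U hmax hLH hU a ha hev
  have h := level_energy_ratio_frequently_gt ν T hν hT u p U hmax hLH hU a ha
  exact (h.and_eventually hev).exists.elim fun j hj => (not_le.mpr hj.1) hj.2

end Summit.NavierStokesRegularity.FluidComputer.LevelEnergyFloor
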